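import Summits.NavierStokesRegularity.FluidComputer.CriticalLevels
import HarnessLib

/-!
# Fluid computer — the CRITICAL FACE of the level dictionary, IIIb: the critical tail dominates the enstrophy tail

HONEST FRAMING (cell `pub-fluidc`, verbatim): *low prior, high value-of-information experiment on Tao's
machine paradigm; NOT a claim that NS blows up.* Theorem side of the cell; nothing here is evidence of blow-up.
A bookkeeping companion of `CriticalLevels` (L29″, `besovHalf_tail_tendsto_top`: for every level `J` the
critically weighted block energies above `J`, `∑_{n≥0} 2^{(J+n)/2} ‖Δ̇_{J+n} u(t)‖₂`, tend to `∞` as `t ↑ T`) and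
`LerayTailDivergence` (L26: the dyadic enstrophy above `J`, `∑_{n≥0} 4^{J+n} ‖Δ̇_{J+n} u(t)‖₂²`, tends to `∞`). The
comparison announced in the docstrings of `CriticalLevels` is formalised here, at the level of a single field:

* `besovHalf_tail_sq_le` — Cauchy–Schwarz: `(∑_{n≥0} 2^{(J+n)/2} a_{J+n})² ≤ (∑_{n≥0} 2^{−(J+n)}) · ∑_{n≥0} (2^{J+n} a_{J+n})²`
  (Hölder `(2, 2)` for the counting measure on `ℕ`, Mathlib's `ENNReal.lintegral_mul_le_Lp_mul_Lq`);
* `tsum_two_rpow_neg` — `∑_{n≥0} 2^{−(J+n)} = 2^{1−J}`;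
* `besovHalf_tail_sq_le_dyadic_tail` — hence `(critical tail above J)² ≤ 2^{1−J} · (enstrophy tail above J)`: the
  scale-free divergence L29″ is, level by level, the STRONGER statement and implies L26.

Pure bookkeeping on `[0, ∞]`-valued sums; no Navier–Stokes input. 0 sorry; no new definitions, no named facts.

## References

* H. Bahouri, J.-Y. Chemin, R. Danchin, *Fourier Analysis and Nonlinear PDE*, Springer 2011, §2.2 (dyadic
  characterisations; comparisons between `ℓ¹`- and `ℓ²`-weighted level sums are Cauchy–Schwarz in the level
  index). [BahouriCheminDanchin2011]
-/

noncomputable section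

open MeasureTheory Set Function Filter Topology
open scoped ENNReal NNReal
open Literature.Analysis.FluidPDE Literature.Analysis.FunctionSpaces

namespace Summit.NavierStokesRegularity.FluidComputer.CriticalTailComparison

/-- **Cauchy–Schwarz for the critical tail**: for every field `v : ℝ³ → ℝ³` and every level `J ∈ ℤ`,
`(∑_{n≥0} 2^{(J+n)/2} ‖Δ̇_{J+n} v‖₂)² ≤ (∑_{n≥0} 2^{−(J+n)}) · ∑_{n≥0} (2^{J+n} ‖Δ̇_{J+n} v‖₂)²` — write
`2^{(J+n)/2} a = 2^{−(J+n)/2} · (2^{J+n} a)` and apply Hölder with exponents `(2, 2)` for the counting measure on `ℕ`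
(`ENNReal.lintegral_mul_le_Lp_mul_Lq`, `lintegral_count`). [folklore] -/
theorem besovHalf_tail_sq_le (v : EuclideanSpace ℝ (Fin 3) → EuclideanSpace ℝ (Fin 3)) (J : ℤ) :
    (∑' n : ℕ, (2 : ℝ≥0∞) ^ (((J + n : ℤ) : ℝ) / 2) * blockL2 v (J + n)) ^ 2 ≤
      (∑' n : ℕ, (2 : ℝ≥0∞) ^ (-((J + n : ℤ) : ℝ))) *
        ∑' n : ℕ, ((2 : ℝ≥0∞) ^ ((J + n : ℤ) : ℝ) * blockL2 v (J + n)) ^ 2 := by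
  set f : ℕ → ℝ≥0∞ := fun n => (2 : ℝ≥0∞) ^ (-((J + n : ℤ) : ℝ) / 2) with hf
  set g : ℕ → ℝ≥0∞ := fun n => (2 : ℝ≥0∞) ^ ((J + n : ℤ) : ℝ) * blockL2 v (J + n) with hg
  -- the summand is `f n * g n`
  have hfg : ∀ n : ℕ, (2 : ℝ≥0∞) ^ (((J + n : ℤ) : ℝ) / 2) * blockL2 v (J + n) = f n * g n := by
    intro n
    rw [hf, hg, ← mul_assoc, ← ENNReal.rpow_add _ _ two_ne_zero ENNReal.ofNat_ne_top]
    congr 2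
    ring
  -- Hölder `(2, 2)` for the counting measure on `ℕ`
  have hH := ENNReal.lintegral_mul_le_Lp_mul_Lq (Measure.count : Measure ℕ) Real.HolderConjugate.two_two
    (f := f) (g := g) Measurable.of_discrete.aemeasurable Measurable.of_discrete.aemeasurable
  simp only [lintegral_count, Pi.mul_apply] at hH
  have hf2 : ∀ n : ℕ, f n ^ (2 : ℝ) = (2 : ℝ≥0∞) ^ (-((J + n : ℤ) : ℝ)) := by
    intro n
    rw [hf, ← ENNReal.rpow_mul]
    congr 1
    ring
  have hg2 : ∀ n : ℕ, g n ^ (2 : ℝ) = ((2 : ℝ≥0∞) ^ ((J + n : ℤ) : ℝ) * blockL2 v (J + n)) ^ 2 := by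
    intro n
    rw [hg, ← ENNReal.rpow_natCast]
    norm_num
  simp only [hf2, hg2] at hH
  calc (∑' n : ℕ, (2 : ℝ≥0∞) ^ (((J + n : ℤ) : ℝ) / 2) * blockL2 v (J + n)) ^ 2
      = (∑' n : ℕ, f n * g n) ^ 2 := by simp only [hfg]
    _ ≤ ((∑' n : ℕ, (2 : ℝ≥0∞) ^ (-((J + n : ℤ) : ℝ))) ^ (1 / (2 : ℝ)) *
          (∑' n : ℕ, ((2 : ℝ≥0∞) ^ ((J + n : ℤ) : ℝ) * blockL2 v (J + n)) ^ 2) ^ (1 / (2 : ℝ))) ^ 2 :=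
        pow_le_pow_left' hH 2
    _ = (∑' n : ℕ, (2 : ℝ≥0∞) ^ (-((J + n : ℤ) : ℝ))) *
          ∑' n : ℕ, ((2 : ℝ≥0∞) ^ ((J + n : ℤ) : ℝ) * blockL2 v (J + n)) ^ 2 := by
        rw [mul_pow, ← ENNReal.rpow_natCast, ← ENNReal.rpow_natCast, ← ENNReal.rpow_mul, ← ENNReal.rpow_mul]
        norm_num

/-- **The geometric weight sum**: `∑_{n≥0} 2^{−(J+n)} = 2^{1−J}` (in `[0, ∞]`). [folklore] -/
theorem tsum_two_rpow_neg (J : ℤ) :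
    ∑' n : ℕ, (2 : ℝ≥0∞) ^ (-((J + n : ℤ) : ℝ)) = (2 : ℝ≥0∞) ^ (1 - (J : ℝ)) := by
  have hterm : ∀ n : ℕ, (2 : ℝ≥0∞) ^ (-((J + n : ℤ) : ℝ)) = (2 : ℝ≥0∞) ^ (-(J : ℝ)) * (2⁻¹ : ℝ≥0∞) ^ n := by
    intro n
    rw [← ENNReal.rpow_neg_one, ← ENNReal.rpow_natCast, ← ENNReal.rpow_mul,
      ← ENNReal.rpow_add _ _ two_ne_zero ENNReal.ofNat_ne_top]
    congr 1
    push_cast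
    ring
  rw [tsum_congr hterm, ENNReal.tsum_mul_left, ENNReal.tsum_geometric, ENNReal.one_sub_inv_two, inv_inv]
  have h : (2 : ℝ≥0∞) ^ (1 - (J : ℝ)) = (2 : ℝ≥0∞) ^ (-(J : ℝ)) * (2 : ℝ≥0∞) ^ (1 : ℝ) := by
    rw [← ENNReal.rpow_add _ _ two_ne_zero ENNReal.ofNat_ne_top]
    congr 1
    ring
  rw [h, ENNReal.rpow_one]

/-- **THE CRITICAL TAIL DOMINATES THE ENSTROPHY TAIL**: for every field `v` and level `J ∈ ℤ`,
`(∑_{n≥0} 2^{(J+n)/2} ‖Δ̇_{J+n} v‖₂)² ≤ 2^{1−J} ∑_{n≥0} (2^{J+n} ‖Δ̇_{J+n} v‖₂)²`. Hence along a maximal smooth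
Leray–Hopf solution the critical-tail divergence `CriticalLevels.besovHalf_tail_tendsto_top` (L29″) implies the
enstrophy-tail divergence of `LerayTailDivergence` (L26) at every fixed level, with scale-free weights: the
critical statement is the stronger one. [folklore] -/
theorem besovHalf_tail_sq_le_dyadic_tail (v : EuclideanSpace ℝ (Fin 3) → EuclideanSpace ℝ (Fin 3)) (J : ℤ) :
    (∑' n : ℕ, (2 : ℝ≥0∞) ^ (((J + n : ℤ) : ℝ) / 2) * blockL2 v (J + n)) ^ 2 ≤
      (2 : ℝ≥0∞) ^ (1 - (J : ℝ)) * ∑' n : ℕ, ((2 : ℝ≥0∞) ^ ((J + n : ℤ) : ℝ) * blockL2 v (J + n)) ^ 2 := by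
  rw [← tsum_two_rpow_neg J]
  exact besovHalf_tail_sq_le v J

end Summit.NavierStokesRegularity.FluidComputer.CriticalTailComparison

end
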